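import Summits.Ventures.PercRepro.RankLevelSetLevelSplitAll
import Summits.Ventures.PercRepro.RankLevelSetLevelSixGiant

/-!
# PercRepro — THE GIANT-FLAT THRESHOLD MADE UNCONDITIONAL ON THE SPLIT ROW (p8, S3)

`proofs/SUBCLAIM-S3-p8.md` §3d. night-1's split chain gives level `5` for every `p ≥ 175` in the tree
(`c025_five_large_split`, RankLevelSetLevelSplitAll) — exactly the level-`5` row the giant-flat chain asks for. So,
unconditionally, for every finite matroid: **`c025_six_large_giant''` — C-025 at level `6` for every `p ≥ 176`** (and
its `C025`-body spelling). The window of record at `q = 6` becomes `8 ≤ p ≤ 175`. Axioms: standard.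
-/

open scoped Matroid

namespace PercRepro

namespace ThmN

variable {α : Type}

/-- **THEOREM C₆ (the giant-flat count), unconditional**: level `6` for every `p ≥ 176`. -/
theorem c025_six_large_giant'' (M : Matroid α) [M.Finite] (p : ℕ) (hp : 176 ≤ p) : RLS M p 6 :=
  c025_six_of_five_giant (fun M _ p hp => c025_five_large_split M p hp) M p hp

/-- The level-`6` frontier of the counting route in the vocabulary of `C025`: every `p ≥ 176`. -/
theorem c025_six_large_giant''' (M : Matroid α) [M.Finite] (p : ℕ) (hp : 176 ≤ p) :
    phiK p 6 * ({A : Set α | A ⊆ M.E ∧ M.eRk A = (p : ℕ∞) ∧ M.eRk (M.E \ A) = (6 : ℕ∞)}.ncard : ℚ) ≤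
      ({A : Set α | A ⊆ M.E ∧ (6 : ℕ∞) < M.eRk A ∧ M.eRk A < (p : ℕ∞)}.ncard : ℚ) :=
  c025_six_large_giant'' M p hp

end ThmN

end PercRepro
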